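import Literature.Analysis.FluidPDE.JiaSverak2013Lemma8SliceTools
import Literature.Analysis.FluidPDE.JiaSverak2013Lemma8WindowTools
import HarnessLib

/-!
# The critical coupling of the caloric layer for split comparison fields

Analysis/FluidPDE proof file (theorems only, no definitions, no named facts) on the way to the
discharge of `Literature.Analysis.FluidPDE.BarkerPrange2020_thm2` (Barker–Prange 2020, Thm. 2) by
compactness. In Jia–Šverák's layer estimate (proof of Lemma 8) the critical coupling
`2∫ χ²⟪g(w), e⟫` (`w = v - e`, `g` its weak gradient, `χ = cutoff 1 (· - x₀)`) is controlled by the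
trilinear bound `two_mul_abs_integral_sq_mul_inner_apply_le` with the Grönwall density `‖e‖₅⁵`.
For the data of Barker–Prange's Theorem 2 the comparison field splits on `B(x₀, 3)` as
`e = e₁ + e₂` with `e₁ ∈ L⁵` (caloric extension of the `L³` near field) and `|e₂| ≤ L` (caloric
extension of the far field); this file bounds the coupling accordingly
(`two_mul_abs_integral_coupling_le_of_split`):
`2|∫ χ²⟪g(w), e⟫| ≤ (3/2)∫χ²|g|² + ∫χ²|w|² + c₁²∫_B|w|² + (K₀‖e₁‖₅⁵ + 2L²)∫χ²|w|²`
(trilinear bound for `e₁`, Cauchy–Schwarz `2ab ≤ a²/2 + 2b²` for `e₂`).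

## References

* H. Jia, V. Šverák, SIAM J. Math. Anal. 45 (2013) 1448–1459 = arXiv:1201.1592, Lemma 8 (p. 7).
  [JiaSverak2013]
* T. Barker, C. Prange, Arch. Ration. Mech. Anal. 236 (2020) 1487–1541 = arXiv:1812.09115, Thm. 2,
  §4.2 (p. 16). [BarkerPrange2020]
-/

noncomputable section

open MeasureTheory TopologicalSpace Set Function Filter Metric InnerProductSpace
open _root_.Topology
open scoped ENNReal NNReal RealInnerProductSpace

namespace Literature.Analysis.FluidPDE

namespace BarkerPrange2020

open FunctionSpaces

set_option maxHeartbeats 3200000 in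
/-- **The critical coupling for a split comparison field.** Let `K₀` be a constant of the
trilinear bound on balls of radius `3` (`two_mul_abs_integral_sq_mul_inner_apply_le 3`), `c₁ ≥ 0` a
bound for `‖D(cutoff 1 (· - x₀))‖`, `e₁` continuous with `‖e₁‖₅ < ∞`, `|e₂| ≤ L` on `B(x₀, 3)`
(`e₂` continuous), and `e = e₁ + e₂` on `B(x₀, 3)`. Then for every `w ∈ L²(B(x₀,3))` with weak
derivative `g`, `∫_B |g|² < ∞`, and `χ = cutoff 1 (· - x₀)`:
`2|∫ χ²⟪g(w), e⟫| ≤ (3/2)∫χ²|g|²_F + ∫χ²|w|² + c₁²∫_{B(x₀,3)}|w|² + (K₀‖e₁‖₅⁵ + 2L²)∫χ²|w|²`.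
[cite: JiaSverak2013, Lemma 8, proof (arXiv:1201.1592 p. 7); BarkerPrange2020, §4.2 (arXiv:1812.09115 p. 16)] -/
theorem two_mul_abs_integral_coupling_le_of_split {K₀ : ℝ} (x₀ : EuclideanSpace ℝ (Fin 3))
    (htri : ∀ (w : EuclideanSpace ℝ (Fin 3) → EuclideanSpace ℝ (Fin 3))
      (g : EuclideanSpace ℝ (Fin 3) → EuclideanSpace ℝ (Fin 3) →L[ℝ] EuclideanSpace ℝ (Fin 3))
      (χ : EuclideanSpace ℝ (Fin 3) → ℝ) (c : ℝ) (ε : EuclideanSpace ℝ (Fin 3) → EuclideanSpace ℝ (Fin 3)),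
      HasWeakFDerivOn (⟨ball x₀ 3, isOpen_ball⟩ : Opens (EuclideanSpace ℝ (Fin 3))) volume w g →
      ∫⁻ x in ball x₀ 3, ‖w x‖ₑ ^ 2 < ∞ →
      ∫⁻ x in ball x₀ 3, ENNReal.ofReal (frobeniusNormSq (g x)) < ∞ →
      ContDiff ℝ (⊤ : ℕ∞) χ → tsupport χ ⊆ ball x₀ 3 → (∀ x, |χ x| ≤ 1) → 0 ≤ c →
      (∀ x, ‖fderiv ℝ χ x‖ ≤ c) → Continuous ε → eLpNorm ε 5 volume < ∞ →
      2 * |∫ x, χ x ^ 2 * ⟪g x (w x), ε x⟫| ≤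
        (∫ x, χ x ^ 2 * frobeniusNormSq (g x)) + (∫ x, χ x ^ 2 * ‖w x‖ ^ 2) +
          c ^ 2 * (∫ x in ball x₀ 3, ‖w x‖ ^ 2) +
          K₀ * (eLpNorm ε 5 volume).toReal ^ 5 * ∫ x, χ x ^ 2 * ‖w x‖ ^ 2)
    {c₁ : ℝ} (hc₁ : 0 ≤ c₁) (hDχ : ∀ x, ‖fderiv ℝ (fun y => cutoff (1 : ℝ) (y - x₀)) x‖ ≤ c₁)
    {e e₁ e₂ : EuclideanSpace ℝ (Fin 3) → EuclideanSpace ℝ (Fin 3)} (he₁c : Continuous e₁)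
    (he₁5 : eLpNorm e₁ 5 volume < ∞) (he₂c : Continuous e₂) {L : ℝ} (hL : 0 ≤ L)
    (he₂ : ∀ x ∈ ball x₀ 3, ‖e₂ x‖ ≤ L) (hsplit : ∀ x ∈ ball x₀ 3, e x = e₁ x + e₂ x)
    (w : EuclideanSpace ℝ (Fin 3) → EuclideanSpace ℝ (Fin 3))
    (g : EuclideanSpace ℝ (Fin 3) → EuclideanSpace ℝ (Fin 3) →L[ℝ] EuclideanSpace ℝ (Fin 3))
    (hw : HasWeakFDerivOn (⟨ball x₀ 3, isOpen_ball⟩ : Opens (EuclideanSpace ℝ (Fin 3))) volume w g)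
    (hw2 : ∫⁻ x in ball x₀ 3, ‖w x‖ₑ ^ 2 < ∞)
    (hg2 : ∫⁻ x in ball x₀ 3, ENNReal.ofReal (frobeniusNormSq (g x)) < ∞) :
    2 * |∫ x, cutoff (1 : ℝ) (x - x₀) ^ 2 * ⟪g x (w x), e x⟫| ≤
      3 / 2 * (∫ x, cutoff (1 : ℝ) (x - x₀) ^ 2 * frobeniusNormSq (g x)) +
        (∫ x, cutoff (1 : ℝ) (x - x₀) ^ 2 * ‖w x‖ ^ 2) +
        c₁ ^ 2 * (∫ x in ball x₀ 3, ‖w x‖ ^ 2) +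
        1 * (K₀ * (eLpNorm e₁ 5 volume).toReal ^ 5 + 2 * L ^ 2) * ∫ x, cutoff (1 : ℝ) (x - x₀) ^ 2 * ‖w x‖ ^ 2 := by
  -- ### the cut-off
  set χ : EuclideanSpace ℝ (Fin 3) → ℝ := fun x => cutoff (1 : ℝ) (x - x₀) with hχdef
  have hχ_app : ∀ x, cutoff (1 : ℝ) (x - x₀) = χ x := fun x => rfl
  simp only [hχ_app]
  set B : Set (EuclideanSpace ℝ (Fin 3)) := ball x₀ 3 with hBdef
  have hBm : MeasurableSet B := measurableSet_ball
  set μB : Measure (EuclideanSpace ℝ (Fin 3)) := volume.restrict B with hμB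
  have hχs : ContDiff ℝ (⊤ : ℕ∞) χ := (contDiff_cutoff 1).comp (contDiff_id.sub contDiff_const)
  have hχc : Continuous χ := hχs.continuous
  have hχ1 : ∀ x, |χ x| ≤ 1 := fun x => abs_cutoff_le_one 1 _
  have hχsq1 : ∀ x, χ x ^ 2 ≤ 1 := fun x => by
    have := hχ1 x; rw [← sq_abs]; nlinarith [abs_nonneg (χ x)]
  have hχsupp : support χ ⊆ ball x₀ 2 := by
    intro x hx
    rw [mem_support] at hx
    rw [mem_ball, dist_eq_norm]
    by_contra hc
    exact hx (cutoff_eq_zero one_pos (by linarith [not_lt.1 hc]))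
  have hχts : tsupport χ ⊆ closedBall x₀ 2 :=
    (closure_mono hχsupp).trans (closure_ball_subset_closedBall)
  have hχB : tsupport χ ⊆ B := hχts.trans (closedBall_subset_ball (by norm_num))
  have hχzero : ∀ x, x ∉ B → χ x = 0 := fun x hx => by
    by_contra h
    exact hx (ball_subset_ball (by norm_num) (hχsupp (mem_support.2 h)))
  -- ### measurability and integrability on `B`
  have hwm : AEStronglyMeasurable w μB := hw.locallyIntegrableOn.aestronglyMeasurable
  have hgm : AEStronglyMeasurable g μB := hw.locallyIntegrableOn_deriv.aestronglyMeasurable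
  have hfrob_c : Continuous fun L' : (EuclideanSpace ℝ (Fin 3)) →L[ℝ] (EuclideanSpace ℝ (Fin 3)) =>
      frobeniusNormSq L' := by
    unfold frobeniusNormSq
    exact continuous_finsetSum _ fun i _ =>
      ((ContinuousLinearMap.apply ℝ (EuclideanSpace ℝ (Fin 3))
        (stdOrthonormalBasis ℝ (EuclideanSpace ℝ (Fin 3)) i)).continuous.norm).pow 2
  have hfrobm : AEStronglyMeasurable (fun x => frobeniusNormSq (g x)) μB := hfrob_c.comp_aestronglyMeasurable hgm
  have hgwm : AEStronglyMeasurable (fun x => g x (w x)) μB := aestronglyMeasurable_clm_apply₂ hgm hwm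
  -- `‖w‖²` and `|g|²_F` are integrable on `B`
  have iw2 : Integrable (fun x => ‖w x‖ ^ 2) μB := by
    refine ⟨(hwm.norm.pow 2), ?_⟩
    rw [hasFiniteIntegral_iff_enorm]
    refine lt_of_le_of_lt (lintegral_mono fun x => le_of_eq ?_) hw2
    rw [Real.enorm_eq_ofReal (sq_nonneg _), ← ofReal_norm, ENNReal.ofReal_pow (norm_nonneg _)]
  have ifrob : Integrable (fun x => frobeniusNormSq (g x)) μB := by
    refine ⟨hfrobm, ?_⟩
    rw [hasFiniteIntegral_iff_enorm]
    refine lt_of_le_of_lt (lintegral_mono fun x => le_of_eq ?_) hg2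
    rw [Real.enorm_eq_ofReal (frobeniusNormSq_nonneg _)]
  have hgn : ∀ x, ‖g x‖ ^ 2 ≤ frobeniusNormSq (g x) := fun x =>
    sq_opNorm_le_sum_sq_norm_apply (stdOrthonormalBasis ℝ (EuclideanSpace ℝ (Fin 3))) _
  have hgw : ∀ x, ‖g x (w x)‖ ≤ Real.sqrt (frobeniusNormSq (g x)) * ‖w x‖ := fun x =>
    norm_clm_apply_le_sqrt_frobeniusNormSq_mul_norm _ _
  -- `ab ≤ (a² + b²)/2` with `a = √|g|²_F`, `b = ‖w‖`
  have hgw' : ∀ x, ‖g x (w x)‖ ≤ (frobeniusNormSq (g x) + ‖w x‖ ^ 2) / 2 := fun x => by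
    have h1 := hgw x
    have h2 : Real.sqrt (frobeniusNormSq (g x)) ^ 2 = frobeniusNormSq (g x) := Real.sq_sqrt (frobeniusNormSq_nonneg _)
    nlinarith [sq_nonneg (Real.sqrt (frobeniusNormSq (g x)) - ‖w x‖), Real.sqrt_nonneg (frobeniusNormSq (g x)),
      norm_nonneg (w x)]
  -- a bound for `e₁` on the closed ball
  obtain ⟨C₁, hC₁⟩ := (isCompact_closedBall x₀ 3).exists_bound_of_continuousOn he₁c.continuousOn
  have hC₁0 : 0 ≤ C₁ := (norm_nonneg _).trans (hC₁ x₀ (mem_closedBall_self (by norm_num)))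
  have he₁B : ∀ x ∈ B, ‖e₁ x‖ ≤ C₁ := fun x hx => hC₁ x (ball_subset_closedBall hx)
  -- ### the three integrands
  set I : EuclideanSpace ℝ (Fin 3) → ℝ := fun x => χ x ^ 2 * ⟪g x (w x), e x⟫ with hI
  set I₁ : EuclideanSpace ℝ (Fin 3) → ℝ := fun x => χ x ^ 2 * ⟪g x (w x), e₁ x⟫ with hI₁
  set I₂ : EuclideanSpace ℝ (Fin 3) → ℝ := fun x => χ x ^ 2 * ⟪g x (w x), e₂ x⟫ with hI₂
  have hI12 : ∀ x, I x = I₁ x + I₂ x := by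
    intro x
    by_cases hx : x ∈ B
    · simp only [hI, hI₁, hI₂, hsplit x hx, inner_add_right]; ring
    · simp only [hI, hI₁, hI₂, hχzero x hx]; ring
  -- integrability of `I₁`, `I₂` (dominated by `C (|g|²_F + ‖w‖²)` on `B`, zero off `B`)
  have domI : ∀ {ε : EuclideanSpace ℝ (Fin 3) → EuclideanSpace ℝ (Fin 3)} {C : ℝ}, Continuous ε → 0 ≤ C →
      (∀ x ∈ B, ‖ε x‖ ≤ C) → Integrable (fun x => χ x ^ 2 * ⟪g x (w x), ε x⟫) volume := by
    intro ε C hεc hC0 hεB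
    have hsuppI : support (fun x => χ x ^ 2 * ⟪g x (w x), ε x⟫) ⊆ B := by
      intro x hx
      by_contra hxB
      rw [mem_support] at hx
      exact hx (by rw [hχzero x hxB]; ring)
    refine (integrableOn_iff_integrable_of_support_subset hsuppI).1 ?_
    have hm : AEStronglyMeasurable (fun x => χ x ^ 2 * ⟪g x (w x), ε x⟫) μB :=
      ((hχc.pow 2).aestronglyMeasurable).mul (hgwm.inner hεc.aestronglyMeasurable)
    refine Integrable.mono' ((ifrob.add iw2).const_mul (C / 2)) hm ?_
    refine (ae_restrict_iff' hBm).2 (Eventually.of_forall fun x hx => ?_)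
    rw [Real.norm_eq_abs, abs_mul, abs_of_nonneg (sq_nonneg _)]
    have h1 : |⟪g x (w x), ε x⟫| ≤ ‖g x (w x)‖ * ‖ε x‖ := abs_real_inner_le_norm _ _
    have h2 : ‖g x (w x)‖ * ‖ε x‖ ≤ (frobeniusNormSq (g x) + ‖w x‖ ^ 2) / 2 * C :=
      mul_le_mul (hgw' x) (hεB x hx) (norm_nonneg _)
        (by have := frobeniusNormSq_nonneg (g x); positivity)
    have h3 : 0 ≤ (frobeniusNormSq (g x) + ‖w x‖ ^ 2) / 2 * C := by
      have := frobeniusNormSq_nonneg (g x); positivity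
    calc χ x ^ 2 * |⟪g x (w x), ε x⟫| ≤ 1 * ((frobeniusNormSq (g x) + ‖w x‖ ^ 2) / 2 * C) :=
          mul_le_mul (hχsq1 x) (h1.trans h2) (abs_nonneg _) zero_le_one
      _ = C / 2 * (frobeniusNormSq (g x) + ‖w x‖ ^ 2) := by ring
      _ = C / 2 * ((fun x => frobeniusNormSq (g x)) + fun x => ‖w x‖ ^ 2) x := rfl
  have iI₁ : Integrable I₁ volume := domI he₁c hC₁0 he₁B
  have iI₂ : Integrable I₂ volume := domI he₂c hL he₂
  -- ### the two other integrands `χ²|g|²_F`, `χ²‖w‖²` are integrable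
  have dom2 : ∀ {q : EuclideanSpace ℝ (Fin 3) → ℝ}, Integrable q μB → AEStronglyMeasurable q μB →
      Integrable (fun x => χ x ^ 2 * q x) volume := by
    intro q iq hqm
    have hsupp : support (fun x => χ x ^ 2 * q x) ⊆ B := by
      intro x hx
      by_contra hxB
      rw [mem_support] at hx
      exact hx (by rw [hχzero x hxB]; ring)
    refine (integrableOn_iff_integrable_of_support_subset hsupp).1 ?_
    exact iq.bdd_mul (hχc.pow 2).aestronglyMeasurable.restrict
      (Eventually.of_forall fun x => by
        rw [Real.norm_eq_abs, abs_of_nonneg (sq_nonneg _)]; exact hχsq1 x)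
  have iD : Integrable (fun x => χ x ^ 2 * frobeniusNormSq (g x)) volume := dom2 ifrob hfrobm
  have iY : Integrable (fun x => χ x ^ 2 * ‖w x‖ ^ 2) volume := dom2 iw2 (hwm.norm.pow 2)
  -- ### the near part: the trilinear bound
  have hnear := htri w g χ c₁ e₁ hw hw2 hg2 hχs hχB hχ1 hc₁ hDχ he₁c he₁5
  -- ### the far part: Cauchy–Schwarz
  have hfar : 2 * |∫ x, I₂ x| ≤ 1 / 2 * (∫ x, χ x ^ 2 * frobeniusNormSq (g x)) +
      2 * L ^ 2 * ∫ x, χ x ^ 2 * ‖w x‖ ^ 2 := by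
    have hpt : ∀ x, 2 * |I₂ x| ≤ 1 / 2 * (χ x ^ 2 * frobeniusNormSq (g x)) + 2 * L ^ 2 * (χ x ^ 2 * ‖w x‖ ^ 2) := by
      intro x
      by_cases hx : x ∈ B
      · simp only [hI₂]
        rw [abs_mul, abs_of_nonneg (sq_nonneg _)]
        have h1 : |⟪g x (w x), e₂ x⟫| ≤ ‖g x (w x)‖ * ‖e₂ x‖ := abs_real_inner_le_norm _ _
        have h2 : ‖g x (w x)‖ * ‖e₂ x‖ ≤ Real.sqrt (frobeniusNormSq (g x)) * ‖w x‖ * L :=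
          mul_le_mul (hgw x) (he₂ x hx) (norm_nonneg _)
            (mul_nonneg (Real.sqrt_nonneg _) (norm_nonneg _))
        have h3 : Real.sqrt (frobeniusNormSq (g x)) ^ 2 = frobeniusNormSq (g x) :=
          Real.sq_sqrt (frobeniusNormSq_nonneg _)
        -- `2 χ² (a b L) ≤ χ²(a²/2 + 2 L² b²)`
        have h4 : 2 * (Real.sqrt (frobeniusNormSq (g x)) * ‖w x‖ * L) ≤
            1 / 2 * frobeniusNormSq (g x) + 2 * L ^ 2 * ‖w x‖ ^ 2 := by
          nlinarith [sq_nonneg (Real.sqrt (frobeniusNormSq (g x)) - 2 * L * ‖w x‖), h3]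
        have hχ0 : 0 ≤ χ x ^ 2 := sq_nonneg _
        calc 2 * (χ x ^ 2 * |⟪g x (w x), e₂ x⟫|) ≤ χ x ^ 2 * (2 * (Real.sqrt (frobeniusNormSq (g x)) * ‖w x‖ * L)) := by
              nlinarith [h1.trans h2, hχ0]
          _ ≤ χ x ^ 2 * (1 / 2 * frobeniusNormSq (g x) + 2 * L ^ 2 * ‖w x‖ ^ 2) :=
              mul_le_mul_of_nonneg_left h4 hχ0
          _ = _ := by ring
      · simp only [hI₂, hχzero x hx]
        simp
    calc 2 * |∫ x, I₂ x| ≤ 2 * ∫ x, |I₂ x| := by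
          have := abs_integral_le_integral_abs (f := I₂) (μ := volume)
          linarith
      _ = ∫ x, 2 * |I₂ x| := (integral_const_mul 2 _).symm
      _ ≤ ∫ x, (1 / 2 * (χ x ^ 2 * frobeniusNormSq (g x)) + 2 * L ^ 2 * (χ x ^ 2 * ‖w x‖ ^ 2)) :=
          integral_mono (iI₂.abs.const_mul 2) ((iD.const_mul _).add (iY.const_mul _)) hpt
      _ = 1 / 2 * (∫ x, χ x ^ 2 * frobeniusNormSq (g x)) + 2 * L ^ 2 * ∫ x, χ x ^ 2 * ‖w x‖ ^ 2 := by
          rw [integral_add (iD.const_mul _) (iY.const_mul _), integral_const_mul, integral_const_mul]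
  -- ### conclusion
  have hsplitI : (∫ x, I x) = (∫ x, I₁ x) + ∫ x, I₂ x := by
    rw [← integral_add iI₁ iI₂]
    exact integral_congr_ae (Eventually.of_forall hI12)
  have habs : |∫ x, I x| ≤ |∫ x, I₁ x| + |∫ x, I₂ x| := by
    rw [hsplitI]; exact abs_add_le _ _
  have hY0 : 0 ≤ ∫ x, χ x ^ 2 * ‖w x‖ ^ 2 := integral_nonneg fun x => by positivity
  have hD0 : 0 ≤ ∫ x, χ x ^ 2 * frobeniusNormSq (g x) :=
    integral_nonneg fun x => mul_nonneg (sq_nonneg _) (frobeniusNormSq_nonneg _)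
  nlinarith [habs, hnear, hfar, hY0, hD0]

end BarkerPrange2020

end Literature.Analysis.FluidPDE

end
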